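import Summits.KontsevichZagierPeriods.KontsevichZagierPeriods.Theses.SymplecticScissors
import Summits.KontsevichZagierPeriods.KontsevichZagierPeriods.Theorems.RealOnePeriodRelations.Negative.Kit
import Literature.NumberTheory.Transcendental.KZCalculus
import Literature.NumberTheory.Transcendental.CurvePeriods
import Literature.NumberTheory.Transcendental.CurvePeriodsPathHomotopicProofs
import Literature.NumberTheory.Transcendental.SemialgebraicMaps

/-!
# `RealOnePeriodRelations` (stmt-KontsevichZagierPeriods-10042, route SymplecticScissors) —
# line `nash-retraction-thin-strip`, lead skeleton, RESHAPE 2 (chart-grid coherence engine; apex = route crux 14055)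

The crux: every `ℤ`-combination `c` of 1-dimensional KZ integral representations with `eval c = 0` lies
in `M₁ = closure(domainAddRel ∪ integrandAddRel ∪ changeOfVariablesRel ∪ Green)` (`M₁`, `H₁`, `crux_iff`
from the landed kit `Theorems/RealOnePeriodRelations/Negative/Kit.lean`).

Line (composition idea unchanged from the card `Ideas/nash-retraction-thin-strip.md`): normalise `c` to real
realisations of period symbols `(Z, ω, γ)` of curve type along `ℚ`-semialgebraic `C¹` paths
(`stub_normalisation`, the map `Ψ`); Huber–Wüstholz Thm 13.3 (2) (`stub_huberWustholz` = the cited tree fact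
`HuberWustholzCurvePeriods`, not staffed) writes `Ψ(c)` as a `ℚ̄`-combination of elementary relations
R1–R5; a RETRACTION `Θ` (`stub_retraction`) sends `a · (Z, ω, γ)` to the real representation
`[∫₀¹ Re(a·ω(γ̃)γ̃′) dt]` along a CHOSEN `ℚ`-semialgebraic `C¹` path `γ̃` on `Z` homotopic to `γ` with fixed
end points (`stub_saHomotopic`; representations exist by `stub_realises`); `Θ` is well defined modulo `M₁`
and kills R4/R5 because of HOMOTOPY COHERENCE (`stub_homotopyInvariance`: two semialgebraic `C¹` paths on
`Z` homotopic rel end points realise the same class mod `M₁` — the move-world twin of the tree's PROVED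
`CurvePeriods.span_single_sub_single_of_continuousHomotopy`, by a grid of chart cells
(`stub_saChart`: the holomorphic graph charts of `Z` are `ℚ`-semialgebraic on closed sub-discs) each of
which is ONE Green-on-the-square instance (`stub_cellGreen` ⇐ `stub_greenOnSquare`, two typed triangle
instances)); R1 is rule 1b, R2 a zero integrand, R3 is Newton–Leibniz in dimension one
(`stub_exactDimOne`), R4 the pointwise chain rule + coherence, R5 = concatenation + coherence; and
`Θ ∘ Ψ ≡ id (mod M₁)` on semialgebraic symbols by coherence again.

Reshape 2 (this lead, 2026-08-16): the thin-strip / Nash-tube coherence of reshape 1 (stubs `stub_nashTube`,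
`stub_stripGreenData`, `stub_approximants`, `IsCoherenceRadius`) is REPLACED by homotopy coherence through
the chart grid (the disprover's R4 plan-gap, `Disproof.lean` §6, asks for exactly this; idea card
`chart-grid-transport` ≈ this line per triage). No local definitions: every predicate is inlined in the
registered signatures so that landed stubs drop in verbatim.

Inlined predicates (read them once):
* `IsSAPath γ` ≡ `IsSemialgebraicMapOn ℚ {z : Fin 1 → ℝ | z 0 ∈ Icc 0 1} (fun z => Fin.append (re ∘ γ (z 0)) (im ∘ γ (z 0)))`;
* `Realises r a ω γ` ≡ `r.domain = {z | z 0 ∈ Ioo 0 1} ∧ ∀ z ∈ r.domain, r.integrand z = Re (a · Σᵢ ωᵢ(γ(z 0)) · γᵢ′(z 0))`;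
* `Homotopic γ₀ γ₁` (on `Z`) ≡ `∃ x y (p₀ p₁ : Path x y), (∀ t, γ₀ t = p₀ t) ∧ (∀ t, γ₁ t = p₁ t) ∧ p₀.Homotopic p₁`
  in the subspace `Z.points` (format of `CurvePeriods.span_single_sub_single_of_homotopic`).

References: A. Huber, G. Wüstholz, *Transcendence and Linear Relations of 1-Periods* (CUP 2022), Thm 13.3 (2),
§3.3.1, Cor. 12.7; M. Kontsevich, D. Zagier, *Periods* (2001), §1.2; J. Bochnak, M. Coste, M.-F. Roy, *Real
Algebraic Geometry* (1998), §2.2; J. B. Conway, *Functions of One Complex Variable I* (1978), IV.6.7.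
-/

noncomputable section

open scoped BigOperators unitInterval
open Set MeasureTheory
open Literature.NumberTheory.Transcendental Literature.NumberTheory.Transcendental.CurvePeriods
open Literature.ModelTheory.ExponentialFields (IsSemialgebraic)
open Summit.KontsevichZagierPeriods.SymplecticScissors.RealOnePeriodRelationsNegative (greenSet M₁ H₁ crux_iff)

namespace Summit.KontsevichZagierPeriods.SymplecticScissors.RealOnePeriodRelations

/-! ## Stubs of the line (registered on stmt-KontsevichZagierPeriods-10042) -/

/-- STUB `stub_saChart` (M/L). SEMIALGEBRAIC GRAPH CHARTS: at every point `z₀` of a smooth affine curve `Z`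
over `ℚ̄` there is a holomorphic graph chart `ψ` over a coordinate `i₀` exactly as delivered by the tree's
`CurveData.IsSmoothAffineCurve.exists_localChart`, together with a radius `0 < ρ < ε` such that `ψ` is a
`ℚ`-SEMIALGEBRAIC map on a closed disc `closedBall c ρ` with `z₀ i₀ ∈ ball c (ρ/6)` (centre `c` may be taken
Gaussian-rational and `ρ` rational — `z₀` itself need not be algebraic; realification `ℂ = ℝ²`, `ℂⁿ = ℝ²ⁿ`):
its graph there is `{(w, z) | z ∈ Z(ℂ) ∩ D, z i₀ = w}` for a rational box `D ⊆ Ω`, and `Z(ℂ) ⊂ ℝ²ⁿ` is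
`ℚ`-semialgebraic (equations with algebraic coefficients; `KZSemialgebraicComplex.re_im_*`). The chart is re-centred
at `c` (analytic on `ball c ε ⊆` the tree's disc). [cite: BochnakCosteRoy1998, §2.2] -/
theorem stub_saChart : ∀ (Z : CurveData), Z.IsSmoothAffineCurve → ∀ z₀ ∈ Z.points,
    ∃ (i₀ : Fin Z.n) (c : ℂ) (ε ρ : ℝ) (Ω : Set (Fin Z.n → ℂ)) (ψ : ℂ → (Fin Z.n → ℂ)),
      0 < ρ ∧ ρ < ε ∧ IsOpen Ω ∧ z₀ ∈ Ω ∧ z₀ i₀ ∈ Metric.ball c (ρ / 6) ∧ AnalyticOnNhd ℂ ψ (Metric.ball c ε) ∧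
      (∀ z ∈ Ω, z ∈ Z.points → z i₀ ∈ Metric.ball c ε ∧ ψ (z i₀) = z) ∧
      (∀ w ∈ Metric.ball c ε, ψ w ∈ Ω ∧ ψ w ∈ Z.points ∧ ψ w i₀ = w) ∧
      IsSemialgebraicMapOn ℚ {q : Fin 2 → ℝ | (⟨q 0, q 1⟩ : ℂ) ∈ Metric.closedBall c ρ}
        (fun q => Fin.append (fun i => (ψ ⟨q 0, q 1⟩ i).re) (fun i => (ψ ⟨q 0, q 1⟩ i).im)) := by
  sorry

/-- STUB `stub_greenOnSquare` (M) — LANDED in `Theorems/SymplecticScissorsRealOnePeriodRelationsStubGreenOnSquare.lean`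
(kept here as a local copy until the final sorry-free skeleton imports the landed files). [cite: KontsevichZagier2001, §1.2] -/
theorem stub_greenOnSquare : ∀ (A B S : (Fin 2 → ℝ) → ℝ),
    IsSemialgebraicFunOn ℚ {p : Fin 2 → ℝ | 0 ≤ p 0 ∧ p 0 ≤ 1 ∧ 0 ≤ p 1 ∧ p 1 ≤ 1} A →
    IsSemialgebraicFunOn ℚ {p : Fin 2 → ℝ | 0 ≤ p 0 ∧ p 0 ≤ 1 ∧ 0 ≤ p 1 ∧ p 1 ≤ 1} B →
    ContinuousOn A {p : Fin 2 → ℝ | 0 ≤ p 0 ∧ p 0 ≤ 1 ∧ 0 ≤ p 1 ∧ p 1 ≤ 1} →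
    ContinuousOn B {p : Fin 2 → ℝ | 0 ≤ p 0 ∧ p 0 ≤ 1 ∧ 0 ≤ p 1 ∧ p 1 ≤ 1} →
    (∀ p : Fin 2 → ℝ, 0 < p 0 → p 0 < 1 → 0 < p 1 → p 1 < 1 →
      HasFDerivAt S (A p • ContinuousLinearMap.proj (R := ℝ) (φ := fun _ : Fin 2 => ℝ) 0 +
        B p • ContinuousLinearMap.proj (R := ℝ) (φ := fun _ : Fin 2 => ℝ) 1) p) →
    ∀ (rB rR rT rL : KZ.IntegralRep 1),
      rB.domain = {z | z 0 ∈ Set.Ioo (0 : ℝ) 1} → rR.domain = {z | z 0 ∈ Set.Ioo (0 : ℝ) 1} →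
      rT.domain = {z | z 0 ∈ Set.Ioo (0 : ℝ) 1} → rL.domain = {z | z 0 ∈ Set.Ioo (0 : ℝ) 1} →
      (∀ z ∈ rB.domain, rB.integrand z = A ![z 0, 0]) → (∀ z ∈ rR.domain, rR.integrand z = B ![1, z 0]) →
      (∀ z ∈ rT.domain, rT.integrand z = A ![z 0, 1]) → (∀ z ∈ rL.domain, rL.integrand z = B ![0, z 0]) →
      KZ.of rB + KZ.of rR - KZ.of rT - KZ.of rL ∈ M₁ := by
  sorry

/-- STUB `stub_cellGreen` (L). THE CHART CELL: given Green on the square (hypothesis, = `stub_greenOnSquare`), a map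
`ψ : ℂ → ℂⁿ` holomorphic on `ball c ε` and `ℚ`-semialgebraic on `closedBall c ρ` (`0 < ρ < ε`), a polynomial form
`ω` over `ℚ̄`, an algebraic scalar `a`, and four `ℚ`-semialgebraic `C¹` chart paths `wb, wr, wt, wl : [0,1] →
closedBall c (ρ/4)` forming a closed quadrilateral (`wb 0 = wl 0`, `wb 1 = wr 0`, `wr 1 = wt 1`, `wl 1 = wt 0`),
the four real realisations of `a·ω` along `ψ ∘ wb, ψ ∘ wr, ψ ∘ wt, ψ ∘ wl` satisfy `[b] + [r] − [t] − [l] ∈ M₁`: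
fill the quadrilateral by the bilinear Coons patch `P : [0,1]² → closedBall c (3ρ/4)` (`C¹`, semialgebraic, within
`3·ρ/4` of `c`), pull back `Re(a·g(w)dw)`, `g = Σᵢ ωᵢ(ψ)ψᵢ′` holomorphic on the ball, to typed Green data
`A = Re(a g(P)∂₁P)`, `B = Re(a g(P)∂₂P)` (semialgebraic: `hasDerivAt_isSemialgebraic_holds`,
`KZSemialgebraicComplex`; continuous on the closed square), potential `S = Re(a G∘P)` with `G′ = g` on the ball
(`DifferentiableOn.isExactOn_ball`), and apply Green on the square. [cite: KontsevichZagier2001, §1.2] -/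
theorem stub_cellGreen :
    (∀ (A B S : (Fin 2 → ℝ) → ℝ),
      IsSemialgebraicFunOn ℚ {p : Fin 2 → ℝ | 0 ≤ p 0 ∧ p 0 ≤ 1 ∧ 0 ≤ p 1 ∧ p 1 ≤ 1} A →
      IsSemialgebraicFunOn ℚ {p : Fin 2 → ℝ | 0 ≤ p 0 ∧ p 0 ≤ 1 ∧ 0 ≤ p 1 ∧ p 1 ≤ 1} B →
      ContinuousOn A {p : Fin 2 → ℝ | 0 ≤ p 0 ∧ p 0 ≤ 1 ∧ 0 ≤ p 1 ∧ p 1 ≤ 1} →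
      ContinuousOn B {p : Fin 2 → ℝ | 0 ≤ p 0 ∧ p 0 ≤ 1 ∧ 0 ≤ p 1 ∧ p 1 ≤ 1} →
      (∀ p : Fin 2 → ℝ, 0 < p 0 → p 0 < 1 → 0 < p 1 → p 1 < 1 →
        HasFDerivAt S (A p • ContinuousLinearMap.proj (R := ℝ) (φ := fun _ : Fin 2 => ℝ) 0 +
          B p • ContinuousLinearMap.proj (R := ℝ) (φ := fun _ : Fin 2 => ℝ) 1) p) →
      ∀ (rB rR rT rL : KZ.IntegralRep 1),
        rB.domain = {z | z 0 ∈ Set.Ioo (0 : ℝ) 1} → rR.domain = {z | z 0 ∈ Set.Ioo (0 : ℝ) 1} →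
        rT.domain = {z | z 0 ∈ Set.Ioo (0 : ℝ) 1} → rL.domain = {z | z 0 ∈ Set.Ioo (0 : ℝ) 1} →
        (∀ z ∈ rB.domain, rB.integrand z = A ![z 0, 0]) → (∀ z ∈ rR.domain, rR.integrand z = B ![1, z 0]) →
        (∀ z ∈ rT.domain, rT.integrand z = A ![z 0, 1]) → (∀ z ∈ rL.domain, rL.integrand z = B ![0, z 0]) →
        KZ.of rB + KZ.of rR - KZ.of rT - KZ.of rL ∈ M₁) →
    ∀ (n : ℕ) (ω : Fin n → MvPolynomial (Fin n) ℂ), (∀ i, HasAlgCoeffs (ω i)) →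
    ∀ (a : ℂ), IsAlgebraic ℚ a →
    ∀ (c : ℂ) (ε ρ : ℝ) (ψ : ℂ → (Fin n → ℂ)), 0 < ρ → ρ < ε → AnalyticOnNhd ℂ ψ (Metric.ball c ε) →
      IsSemialgebraicMapOn ℚ {q : Fin 2 → ℝ | (⟨q 0, q 1⟩ : ℂ) ∈ Metric.closedBall c ρ}
        (fun q => Fin.append (fun i => (ψ ⟨q 0, q 1⟩ i).re) (fun i => (ψ ⟨q 0, q 1⟩ i).im)) →
    ∀ (wb wr wt wl : ℝ → ℂ),
      ContDiffOn ℝ 1 wb (Set.Icc 0 1) → ContDiffOn ℝ 1 wr (Set.Icc 0 1) →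
      ContDiffOn ℝ 1 wt (Set.Icc 0 1) → ContDiffOn ℝ 1 wl (Set.Icc 0 1) →
      IsSemialgebraicMapOn ℚ {z : Fin 1 → ℝ | z 0 ∈ Set.Icc (0 : ℝ) 1} (fun z => ![(wb (z 0)).re, (wb (z 0)).im]) →
      IsSemialgebraicMapOn ℚ {z : Fin 1 → ℝ | z 0 ∈ Set.Icc (0 : ℝ) 1} (fun z => ![(wr (z 0)).re, (wr (z 0)).im]) →
      IsSemialgebraicMapOn ℚ {z : Fin 1 → ℝ | z 0 ∈ Set.Icc (0 : ℝ) 1} (fun z => ![(wt (z 0)).re, (wt (z 0)).im]) →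
      IsSemialgebraicMapOn ℚ {z : Fin 1 → ℝ | z 0 ∈ Set.Icc (0 : ℝ) 1} (fun z => ![(wl (z 0)).re, (wl (z 0)).im]) →
      (∀ t ∈ Set.Icc (0 : ℝ) 1, wb t ∈ Metric.closedBall c (ρ / 4)) →
      (∀ t ∈ Set.Icc (0 : ℝ) 1, wr t ∈ Metric.closedBall c (ρ / 4)) →
      (∀ t ∈ Set.Icc (0 : ℝ) 1, wt t ∈ Metric.closedBall c (ρ / 4)) →
      (∀ t ∈ Set.Icc (0 : ℝ) 1, wl t ∈ Metric.closedBall c (ρ / 4)) →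
      wb 0 = wl 0 → wb 1 = wr 0 → wr 1 = wt 1 → wl 1 = wt 0 →
    ∀ (rb rr rt rl : KZ.IntegralRep 1),
      (rb.domain = {z | z 0 ∈ Set.Ioo (0 : ℝ) 1} ∧ ∀ z ∈ rb.domain, rb.integrand z =
        (a * ∑ i, MvPolynomial.eval (ψ (wb (z 0))) (ω i) * deriv (fun u => ψ (wb u) i) (z 0)).re) →
      (rr.domain = {z | z 0 ∈ Set.Ioo (0 : ℝ) 1} ∧ ∀ z ∈ rr.domain, rr.integrand z =
        (a * ∑ i, MvPolynomial.eval (ψ (wr (z 0))) (ω i) * deriv (fun u => ψ (wr u) i) (z 0)).re) →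
      (rt.domain = {z | z 0 ∈ Set.Ioo (0 : ℝ) 1} ∧ ∀ z ∈ rt.domain, rt.integrand z =
        (a * ∑ i, MvPolynomial.eval (ψ (wt (z 0))) (ω i) * deriv (fun u => ψ (wt u) i) (z 0)).re) →
      (rl.domain = {z | z 0 ∈ Set.Ioo (0 : ℝ) 1} ∧ ∀ z ∈ rl.domain, rl.integrand z =
        (a * ∑ i, MvPolynomial.eval (ψ (wl (z 0))) (ω i) * deriv (fun u => ψ (wl u) i) (z 0)).re) →
      KZ.of rb + KZ.of rr - KZ.of rt - KZ.of rl ∈ M₁ := by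
  sorry

/-- STUB `stub_saPathSubset` (M/L) — LANDED (p77705, `Theorems/SymplecticScissorsRealOnePeriodRelationsStubSaPathSubset.lean`);
local copy until the final skeleton imports it. [cite: HuberWustholz2022, §3.3.1] -/
theorem stub_saPathSubset :
    (∀ (Z : CurveData), Z.IsSmoothAffineCurve → ∀ z₀ ∈ Z.points,
      ∃ (i₀ : Fin Z.n) (c : ℂ) (ε ρ : ℝ) (Ω : Set (Fin Z.n → ℂ)) (ψ : ℂ → (Fin Z.n → ℂ)),
        0 < ρ ∧ ρ < ε ∧ IsOpen Ω ∧ z₀ ∈ Ω ∧ z₀ i₀ ∈ Metric.ball c (ρ / 6) ∧ AnalyticOnNhd ℂ ψ (Metric.ball c ε) ∧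
        (∀ z ∈ Ω, z ∈ Z.points → z i₀ ∈ Metric.ball c ε ∧ ψ (z i₀) = z) ∧
        (∀ w ∈ Metric.ball c ε, ψ w ∈ Ω ∧ ψ w ∈ Z.points ∧ ψ w i₀ = w) ∧
        IsSemialgebraicMapOn ℚ {q : Fin 2 → ℝ | (⟨q 0, q 1⟩ : ℂ) ∈ Metric.closedBall c ρ}
          (fun q => Fin.append (fun i => (ψ ⟨q 0, q 1⟩ i).re) (fun i => (ψ ⟨q 0, q 1⟩ i).im))) →
    ∀ (Z : CurveData), Z.IsSmoothAffineCurve → ∀ (G : Set (Fin Z.n → ℂ)), IsOpen G →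
    ∀ (e : ℝ → (Fin Z.n → ℂ)), ContinuousOn e (Set.Icc 0 1) →
      (∀ t ∈ Set.Icc (0 : ℝ) 1, e t ∈ Z.points) → (∀ t ∈ Set.Icc (0 : ℝ) 1, e t ∈ G) →
      (∀ i, IsAlgebraic ℚ (e 0 i)) → (∀ i, IsAlgebraic ℚ (e 1 i)) →
    ∃ γ : CurvePath Z,
      IsSemialgebraicMapOn ℚ {z : Fin 1 → ℝ | z 0 ∈ Set.Icc (0 : ℝ) 1}
        (fun z => Fin.append (fun i => (γ.toFun (z 0) i).re) (fun i => (γ.toFun (z 0) i).im)) ∧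
      γ.toFun 0 = e 0 ∧ γ.toFun 1 = e 1 ∧ ∀ t ∈ Set.Icc (0 : ℝ) 1, γ.toFun t ∈ G := by
  sorry

/-- STUB `stub_homotopyInvariance` (L/XL — load-bearing). HOMOTOPY COHERENCE IN THE MOVE WORLD: given
semialgebraic charts (hypothesis, = `stub_saChart`) and the chart cell (hypothesis, = conclusion of `stub_cellGreen`),
two `ℚ`-semialgebraic `C¹` paths `γ₀, γ₁` on a smooth affine `Z` with algebraic end points which are homotopic with
fixed end points in `Z(ℂ)` realise `a · ω` equally modulo `M₁`, for every polynomial form `ω` over `ℚ̄` and algebraic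
`a`. The move-world twin of the tree's PROVED `CurvePeriods.span_single_sub_single_of_continuousHomotopy`: a grid of
cells subordinate to semialgebraic charts (`exists_grid_charts` pattern, Lebesgue number, with the cells small enough
that the four cells around every vertex map into `Ω ∩ {z | z i₀ ∈ ball c (ρ/4)}` of one chart; edges inside the
intersection of the two adjacent cell regions by `stub_saPathSubset` (hypothesis), as in the tree's `exists_edgePath`), interior vertices replaced by nearby ALGEBRAIC points
(`CurveData.IsSmoothAffineCurve.exists_algebraicPoint_mem`), side vertices `γᵣ(q/N)` already algebraic (values of a
`ℚ`-semialgebraic function at rational times), chart-straight edges between them, one cell instance per cell, the pieces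
of `γ₀`, `γ₁` summed by 1a + affine rule 2, telescoping (`CurvePeriods.grid_telescope`).
[cite: HuberWustholz2022, §3.3.1] -/
theorem stub_homotopyInvariance :
    (∀ (Z : CurveData), Z.IsSmoothAffineCurve → ∀ z₀ ∈ Z.points,
      ∃ (i₀ : Fin Z.n) (c : ℂ) (ε ρ : ℝ) (Ω : Set (Fin Z.n → ℂ)) (ψ : ℂ → (Fin Z.n → ℂ)),
        0 < ρ ∧ ρ < ε ∧ IsOpen Ω ∧ z₀ ∈ Ω ∧ z₀ i₀ ∈ Metric.ball c (ρ / 6) ∧ AnalyticOnNhd ℂ ψ (Metric.ball c ε) ∧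
        (∀ z ∈ Ω, z ∈ Z.points → z i₀ ∈ Metric.ball c ε ∧ ψ (z i₀) = z) ∧
        (∀ w ∈ Metric.ball c ε, ψ w ∈ Ω ∧ ψ w ∈ Z.points ∧ ψ w i₀ = w) ∧
        IsSemialgebraicMapOn ℚ {q : Fin 2 → ℝ | (⟨q 0, q 1⟩ : ℂ) ∈ Metric.closedBall c ρ}
          (fun q => Fin.append (fun i => (ψ ⟨q 0, q 1⟩ i).re) (fun i => (ψ ⟨q 0, q 1⟩ i).im))) →
    (∀ (Z : CurveData), Z.IsSmoothAffineCurve → ∀ (G : Set (Fin Z.n → ℂ)), IsOpen G →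
      ∀ (e : ℝ → (Fin Z.n → ℂ)), ContinuousOn e (Set.Icc 0 1) →
        (∀ t ∈ Set.Icc (0 : ℝ) 1, e t ∈ Z.points) → (∀ t ∈ Set.Icc (0 : ℝ) 1, e t ∈ G) →
        (∀ i, IsAlgebraic ℚ (e 0 i)) → (∀ i, IsAlgebraic ℚ (e 1 i)) →
      ∃ γ : CurvePath Z,
        IsSemialgebraicMapOn ℚ {z : Fin 1 → ℝ | z 0 ∈ Set.Icc (0 : ℝ) 1}
          (fun z => Fin.append (fun i => (γ.toFun (z 0) i).re) (fun i => (γ.toFun (z 0) i).im)) ∧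
        γ.toFun 0 = e 0 ∧ γ.toFun 1 = e 1 ∧ ∀ t ∈ Set.Icc (0 : ℝ) 1, γ.toFun t ∈ G) →
    (∀ (n : ℕ) (ω : Fin n → MvPolynomial (Fin n) ℂ), (∀ i, HasAlgCoeffs (ω i)) →
      ∀ (a : ℂ), IsAlgebraic ℚ a →
      ∀ (c : ℂ) (ε ρ : ℝ) (ψ : ℂ → (Fin n → ℂ)), 0 < ρ → ρ < ε → AnalyticOnNhd ℂ ψ (Metric.ball c ε) →
        IsSemialgebraicMapOn ℚ {q : Fin 2 → ℝ | (⟨q 0, q 1⟩ : ℂ) ∈ Metric.closedBall c ρ}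
          (fun q => Fin.append (fun i => (ψ ⟨q 0, q 1⟩ i).re) (fun i => (ψ ⟨q 0, q 1⟩ i).im)) →
      ∀ (wb wr wt wl : ℝ → ℂ),
        ContDiffOn ℝ 1 wb (Set.Icc 0 1) → ContDiffOn ℝ 1 wr (Set.Icc 0 1) →
        ContDiffOn ℝ 1 wt (Set.Icc 0 1) → ContDiffOn ℝ 1 wl (Set.Icc 0 1) →
        IsSemialgebraicMapOn ℚ {z : Fin 1 → ℝ | z 0 ∈ Set.Icc (0 : ℝ) 1} (fun z => ![(wb (z 0)).re, (wb (z 0)).im]) →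
        IsSemialgebraicMapOn ℚ {z : Fin 1 → ℝ | z 0 ∈ Set.Icc (0 : ℝ) 1} (fun z => ![(wr (z 0)).re, (wr (z 0)).im]) →
        IsSemialgebraicMapOn ℚ {z : Fin 1 → ℝ | z 0 ∈ Set.Icc (0 : ℝ) 1} (fun z => ![(wt (z 0)).re, (wt (z 0)).im]) →
        IsSemialgebraicMapOn ℚ {z : Fin 1 → ℝ | z 0 ∈ Set.Icc (0 : ℝ) 1} (fun z => ![(wl (z 0)).re, (wl (z 0)).im]) →
        (∀ t ∈ Set.Icc (0 : ℝ) 1, wb t ∈ Metric.closedBall c (ρ / 4)) →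
        (∀ t ∈ Set.Icc (0 : ℝ) 1, wr t ∈ Metric.closedBall c (ρ / 4)) →
        (∀ t ∈ Set.Icc (0 : ℝ) 1, wt t ∈ Metric.closedBall c (ρ / 4)) →
        (∀ t ∈ Set.Icc (0 : ℝ) 1, wl t ∈ Metric.closedBall c (ρ / 4)) →
        wb 0 = wl 0 → wb 1 = wr 0 → wr 1 = wt 1 → wl 1 = wt 0 →
      ∀ (rb rr rt rl : KZ.IntegralRep 1),
        (rb.domain = {z | z 0 ∈ Set.Ioo (0 : ℝ) 1} ∧ ∀ z ∈ rb.domain, rb.integrand z =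
          (a * ∑ i, MvPolynomial.eval (ψ (wb (z 0))) (ω i) * deriv (fun u => ψ (wb u) i) (z 0)).re) →
        (rr.domain = {z | z 0 ∈ Set.Ioo (0 : ℝ) 1} ∧ ∀ z ∈ rr.domain, rr.integrand z =
          (a * ∑ i, MvPolynomial.eval (ψ (wr (z 0))) (ω i) * deriv (fun u => ψ (wr u) i) (z 0)).re) →
        (rt.domain = {z | z 0 ∈ Set.Ioo (0 : ℝ) 1} ∧ ∀ z ∈ rt.domain, rt.integrand z =
          (a * ∑ i, MvPolynomial.eval (ψ (wt (z 0))) (ω i) * deriv (fun u => ψ (wt u) i) (z 0)).re) →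
        (rl.domain = {z | z 0 ∈ Set.Ioo (0 : ℝ) 1} ∧ ∀ z ∈ rl.domain, rl.integrand z =
          (a * ∑ i, MvPolynomial.eval (ψ (wl (z 0))) (ω i) * deriv (fun u => ψ (wl u) i) (z 0)).re) →
        KZ.of rb + KZ.of rr - KZ.of rt - KZ.of rl ∈ M₁) →
    ∀ (Z : CurveData) (hZ : Z.IsSmoothAffineCurve) (ω : Fin Z.n → MvPolynomial (Fin Z.n) ℂ),
      (∀ i, HasAlgCoeffs (ω i)) → ∀ (a : ℂ), IsAlgebraic ℚ a →
    ∀ (γ₀ γ₁ : CurvePath Z),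
      IsSemialgebraicMapOn ℚ {z : Fin 1 → ℝ | z 0 ∈ Set.Icc (0 : ℝ) 1}
        (fun z => Fin.append (fun i => (γ₀.toFun (z 0) i).re) (fun i => (γ₀.toFun (z 0) i).im)) →
      IsSemialgebraicMapOn ℚ {z : Fin 1 → ℝ | z 0 ∈ Set.Icc (0 : ℝ) 1}
        (fun z => Fin.append (fun i => (γ₁.toFun (z 0) i).re) (fun i => (γ₁.toFun (z 0) i).im)) →
      (∃ (x y : Z.points) (p₀ p₁ : Path x y), (∀ t : I, γ₀.toFun t = p₀ t) ∧ (∀ t : I, γ₁.toFun t = p₁ t) ∧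
        p₀.Homotopic p₁) →
    ∀ (r₀ r₁ : KZ.IntegralRep 1),
      (r₀.domain = {z | z 0 ∈ Set.Ioo (0 : ℝ) 1} ∧ ∀ z ∈ r₀.domain, r₀.integrand z =
        (a * ∑ i, MvPolynomial.eval (γ₀.toFun (z 0)) (ω i) * deriv (fun u => γ₀.toFun u i) (z 0)).re) →
      (r₁.domain = {z | z 0 ∈ Set.Ioo (0 : ℝ) 1} ∧ ∀ z ∈ r₁.domain, r₁.integrand z =
        (a * ∑ i, MvPolynomial.eval (γ₁.toFun (z 0)) (ω i) * deriv (fun u => γ₁.toFun u i) (z 0)).re) →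
      KZ.of r₀ - KZ.of r₁ ∈ M₁ := by
  sorry

/-- STUB `stub_saHomotopic` (L). SEMIALGEBRAIC REPRESENTATIVES OF HOMOTOPY CLASSES: given semialgebraic charts
(hypothesis, = `stub_saChart`), every `C¹` path `γ` on a smooth affine `Z` with algebraic end points is homotopic with
fixed end points, inside `Z(ℂ)`, to a `ℚ`-SEMIALGEBRAIC `C¹` path `γ'` (a `CurvePath`): cover `γ` by semialgebraic
chart discs (Lebesgue number), move the break points `γ(r/N)` to nearby ALGEBRAIC points of `Z`
(`CurveData.IsSmoothAffineCurve.exists_algebraicPoint_mem`), join consecutive ones by chart-STRAIGHT segments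
`ψ(b_r + φ(Nt − r)(b_{r+1} − b_r))` reparametrised by the flat cubic `φ(s) = 3s² − 2s³` (so the concatenation is
`C¹` and semialgebraic — the tree's `exists_curvePath_of_path` with `Real.smoothTransition` replaced by `φ`), and
contract each piece onto the corresponding piece of `γ` inside its chart disc. [cite: HuberWustholz2022, §3.3.1] -/
theorem stub_saHomotopic :
    (∀ (Z : CurveData), Z.IsSmoothAffineCurve → ∀ z₀ ∈ Z.points,
      ∃ (i₀ : Fin Z.n) (c : ℂ) (ε ρ : ℝ) (Ω : Set (Fin Z.n → ℂ)) (ψ : ℂ → (Fin Z.n → ℂ)),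
        0 < ρ ∧ ρ < ε ∧ IsOpen Ω ∧ z₀ ∈ Ω ∧ z₀ i₀ ∈ Metric.ball c (ρ / 6) ∧ AnalyticOnNhd ℂ ψ (Metric.ball c ε) ∧
        (∀ z ∈ Ω, z ∈ Z.points → z i₀ ∈ Metric.ball c ε ∧ ψ (z i₀) = z) ∧
        (∀ w ∈ Metric.ball c ε, ψ w ∈ Ω ∧ ψ w ∈ Z.points ∧ ψ w i₀ = w) ∧
        IsSemialgebraicMapOn ℚ {q : Fin 2 → ℝ | (⟨q 0, q 1⟩ : ℂ) ∈ Metric.closedBall c ρ}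
          (fun q => Fin.append (fun i => (ψ ⟨q 0, q 1⟩ i).re) (fun i => (ψ ⟨q 0, q 1⟩ i).im))) →
    (∀ (Z : CurveData), Z.IsSmoothAffineCurve → ∀ (G : Set (Fin Z.n → ℂ)), IsOpen G →
      ∀ (e : ℝ → (Fin Z.n → ℂ)), ContinuousOn e (Set.Icc 0 1) →
        (∀ t ∈ Set.Icc (0 : ℝ) 1, e t ∈ Z.points) → (∀ t ∈ Set.Icc (0 : ℝ) 1, e t ∈ G) →
        (∀ i, IsAlgebraic ℚ (e 0 i)) → (∀ i, IsAlgebraic ℚ (e 1 i)) →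
      ∃ γ : CurvePath Z,
        IsSemialgebraicMapOn ℚ {z : Fin 1 → ℝ | z 0 ∈ Set.Icc (0 : ℝ) 1}
          (fun z => Fin.append (fun i => (γ.toFun (z 0) i).re) (fun i => (γ.toFun (z 0) i).im)) ∧
        γ.toFun 0 = e 0 ∧ γ.toFun 1 = e 1 ∧ ∀ t ∈ Set.Icc (0 : ℝ) 1, γ.toFun t ∈ G) →
    ∀ (Z : CurveData), Z.IsSmoothAffineCurve → ∀ γ : CurvePath Z, ∃ γ' : CurvePath Z,
      IsSemialgebraicMapOn ℚ {z : Fin 1 → ℝ | z 0 ∈ Set.Icc (0 : ℝ) 1}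
        (fun z => Fin.append (fun i => (γ'.toFun (z 0) i).re) (fun i => (γ'.toFun (z 0) i).im)) ∧
      ∃ (x y : Z.points) (p p' : Path x y), (∀ t : I, γ.toFun t = p t) ∧ (∀ t : I, γ'.toFun t = p' t) ∧
        p.Homotopic p' := by
  sorry

/-- STUB `stub_exactDimOne` (M). EXACT FORMS IN DIMENSION ONE: for `u` `ℚ`-semialgebraic and `C¹` on `[0,1]`,
`[∫₀¹ u′(t) dt] − [∫₀¹ (u(1) − u(0)) dt] ∈ M₁` — rule 2 with `Φ = u` on the strict-monotonicity pieces of `u`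
(`semialgebraic_monotonicity_holds`), 1a telescoping and the translation/dilation normal form of constant
representations; or ONE typed Green instance after the flattening `t = 3s² − 2s³`. [cite: KontsevichZagier2001, §1.2 rule (3)] -/
theorem stub_exactDimOne : ∀ (u : ℝ → ℝ),
    IsSemialgebraicFunOn ℚ {z : Fin 1 → ℝ | z 0 ∈ Set.Icc (0 : ℝ) 1} (fun z => u (z 0)) →
    ContDiffOn ℝ 1 u (Set.Icc (0 : ℝ) 1) →
    ∀ (r r' : KZ.IntegralRep 1), r.domain = {z | z 0 ∈ Set.Ioo (0 : ℝ) 1} → r'.domain = {z | z 0 ∈ Set.Ioo (0 : ℝ) 1} →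
      (∀ z ∈ r.domain, r.integrand z = deriv u (z 0)) → (∀ z ∈ r'.domain, r'.integrand z = u 1 - u 0) →
      KZ.of r - KZ.of r' ∈ M₁ := by
  sorry

/-- STUB `stub_realises` (M) — LANDED (p77670, `Theorems/SymplecticScissorsRealOnePeriodRelationsStubRealises.lean`); local copy
until the final skeleton imports it. [cite: KontsevichZagier2001, §1.1] -/
theorem stub_realises : ∀ (Z : CurveData) (γ : CurvePath Z),
    IsSemialgebraicMapOn ℚ {z : Fin 1 → ℝ | z 0 ∈ Set.Icc (0 : ℝ) 1}
      (fun z => Fin.append (fun i => (γ.toFun (z 0) i).re) (fun i => (γ.toFun (z 0) i).im)) →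
    ∀ (ω : Fin Z.n → MvPolynomial (Fin Z.n) ℂ), (∀ i, HasAlgCoeffs (ω i)) → ∀ (a : ℂ), IsAlgebraic ℚ a →
    ∃ r : KZ.IntegralRep 1, r.domain = {z | z 0 ∈ Set.Ioo (0 : ℝ) 1} ∧ ∀ z ∈ r.domain, r.integrand z =
      (a * ∑ i, MvPolynomial.eval (γ.toFun (z 0)) (ω i) * deriv (fun u => γ.toFun u i) (z 0)).re := by
  sorry

/-- STUB `stub_retraction` (L — the transfer `C⁺`, bookkeeping). Given semialgebraic homotopy representatives
(= conclusion of `stub_saHomotopic`), homotopy coherence (= conclusion of `stub_homotopyInvariance`), exactness in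
dimension one (= `stub_exactDimOne`) and realisations (= `stub_realises`), there is `Θ : ℂ → PeriodSymbol → FormalRep`
— `Θ a (Z, ω, γ) = [∫₀¹ Re(a·ω(γ̃)γ̃′)]` along a CHOSEN semialgebraic `C¹` representative `γ̃` of the homotopy class of
`γ` — which (i) kills every `ℚ̄`-combination of elementary relations R1–R5 modulo `M₁` (work in `FormalRep ⧸ M₁`, where
`b ↦ Θ b s` is additive: R1 = 1b; R2 = zero integrand (`γ̃′ ∈ T Z`, `CurvePeriods.deriv_mem_tangentSpace_of_eventually_mem`
pattern); R3 = exactness in dimension one with `u = Re(a·P∘γ̃)`; R4 = pointwise chain rule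
(`CurvePeriods.hasDerivAt_eval_comp`) + coherence on `Z′` between `f∘γ̃` and `γ̃′`; R5 = `[ẽ₀₁] + [ẽ₁₂] ≡ [C¹
semialgebraic concatenation]` by 1a + rule 2 (flat cubic reparametrisation), then coherence with `ẽ₀₂` through the
triangle; complex algebraic multipliers via `Re(ab·) = Re a·Re(b·) − Im a·Re(ib·)` and 1b) and (ii) agrees modulo `M₁`
with every realisation along a semialgebraic symbol path (coherence between `γ̃` and `γ`).
[cite: HuberWustholz2022, Thm 13.3 (2)] -/
theorem stub_retraction :
    (∀ (Z : CurveData), Z.IsSmoothAffineCurve → ∀ γ : CurvePath Z, ∃ γ' : CurvePath Z,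
      IsSemialgebraicMapOn ℚ {z : Fin 1 → ℝ | z 0 ∈ Set.Icc (0 : ℝ) 1}
        (fun z => Fin.append (fun i => (γ'.toFun (z 0) i).re) (fun i => (γ'.toFun (z 0) i).im)) ∧
      ∃ (x y : Z.points) (p p' : Path x y), (∀ t : I, γ.toFun t = p t) ∧ (∀ t : I, γ'.toFun t = p' t) ∧
        p.Homotopic p') →
    (∀ (Z : CurveData) (hZ : Z.IsSmoothAffineCurve) (ω : Fin Z.n → MvPolynomial (Fin Z.n) ℂ),
      (∀ i, HasAlgCoeffs (ω i)) → ∀ (a : ℂ), IsAlgebraic ℚ a →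
      ∀ (γ₀ γ₁ : CurvePath Z),
        IsSemialgebraicMapOn ℚ {z : Fin 1 → ℝ | z 0 ∈ Set.Icc (0 : ℝ) 1}
          (fun z => Fin.append (fun i => (γ₀.toFun (z 0) i).re) (fun i => (γ₀.toFun (z 0) i).im)) →
        IsSemialgebraicMapOn ℚ {z : Fin 1 → ℝ | z 0 ∈ Set.Icc (0 : ℝ) 1}
          (fun z => Fin.append (fun i => (γ₁.toFun (z 0) i).re) (fun i => (γ₁.toFun (z 0) i).im)) →
        (∃ (x y : Z.points) (p₀ p₁ : Path x y), (∀ t : I, γ₀.toFun t = p₀ t) ∧ (∀ t : I, γ₁.toFun t = p₁ t) ∧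
          p₀.Homotopic p₁) →
      ∀ (r₀ r₁ : KZ.IntegralRep 1),
        (r₀.domain = {z | z 0 ∈ Set.Ioo (0 : ℝ) 1} ∧ ∀ z ∈ r₀.domain, r₀.integrand z =
          (a * ∑ i, MvPolynomial.eval (γ₀.toFun (z 0)) (ω i) * deriv (fun u => γ₀.toFun u i) (z 0)).re) →
        (r₁.domain = {z | z 0 ∈ Set.Ioo (0 : ℝ) 1} ∧ ∀ z ∈ r₁.domain, r₁.integrand z =
          (a * ∑ i, MvPolynomial.eval (γ₁.toFun (z 0)) (ω i) * deriv (fun u => γ₁.toFun u i) (z 0)).re) →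
        KZ.of r₀ - KZ.of r₁ ∈ M₁) →
    (∀ (u : ℝ → ℝ), IsSemialgebraicFunOn ℚ {z : Fin 1 → ℝ | z 0 ∈ Set.Icc (0 : ℝ) 1} (fun z => u (z 0)) →
      ContDiffOn ℝ 1 u (Set.Icc (0 : ℝ) 1) →
      ∀ (r r' : KZ.IntegralRep 1), r.domain = {z | z 0 ∈ Set.Ioo (0 : ℝ) 1} →
        r'.domain = {z | z 0 ∈ Set.Ioo (0 : ℝ) 1} →
        (∀ z ∈ r.domain, r.integrand z = deriv u (z 0)) → (∀ z ∈ r'.domain, r'.integrand z = u 1 - u 0) →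
        KZ.of r - KZ.of r' ∈ M₁) →
    (∀ (Z : CurveData) (γ : CurvePath Z),
      IsSemialgebraicMapOn ℚ {z : Fin 1 → ℝ | z 0 ∈ Set.Icc (0 : ℝ) 1}
        (fun z => Fin.append (fun i => (γ.toFun (z 0) i).re) (fun i => (γ.toFun (z 0) i).im)) →
      ∀ (ω : Fin Z.n → MvPolynomial (Fin Z.n) ℂ), (∀ i, HasAlgCoeffs (ω i)) → ∀ (a : ℂ), IsAlgebraic ℚ a →
      ∃ r : KZ.IntegralRep 1, r.domain = {z | z 0 ∈ Set.Ioo (0 : ℝ) 1} ∧ ∀ z ∈ r.domain, r.integrand z =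
        (a * ∑ i, MvPolynomial.eval (γ.toFun (z 0)) (ω i) * deriv (fun u => γ.toFun u i) (z 0)).re) →
    ∃ Θ : ℂ → PeriodSymbol → KZ.FormalRep,
      (∀ (k : ℕ) (ρ : Fin k → (PeriodSymbol →₀ ℂ)) (a : Fin k → ℂ), (∀ l, IsElementaryRelation (ρ l)) →
        (∀ l, IsAlgebraic ℚ (a l)) → ((∑ l, a l • ρ l).sum fun s b => Θ b s) ∈ M₁) ∧
      (∀ (s : PeriodSymbol) (a : ℂ), IsAlgebraic ℚ a →
        IsSemialgebraicMapOn ℚ {z : Fin 1 → ℝ | z 0 ∈ Set.Icc (0 : ℝ) 1}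
          (fun z => Fin.append (fun i => (s.γ.toFun (z 0) i).re) (fun i => (s.γ.toFun (z 0) i).im)) →
        ∀ (r : KZ.IntegralRep 1),
          (r.domain = {z | z 0 ∈ Set.Ioo (0 : ℝ) 1} ∧ ∀ z ∈ r.domain, r.integrand z =
            (a * ∑ i, MvPolynomial.eval (s.γ.toFun (z 0)) (s.ω i) * deriv (fun u => s.γ.toFun u i) (z 0)).re) →
          Θ a s - KZ.of r ∈ M₁) := by
  sorry

/-- STUB `stub_cells` (M/L; first half of `stub_normalisation`). CELLS: every `c ∈ H₁` is, modulo `M₁`, a finite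
`ℤ`-combination of 1-dimensional representations ON THE UNIT INTERVAL whose integrands are `C^∞` on `(0,1)`: write `c` as a
`ℤ`-combination of `[r]`'s (closure induction), cut each `r.domain ⊂ ℝ¹` (a finite union of points and intervals) and the
finitely many non-smooth points of its integrand (`IsSemialgebraicFunOn.exists_contDiffOn_holds`) by rule 1a (null pieces lie
in `M₁`), and map every open piece onto `(0,1)` by rule 2 (affine maps with ALGEBRAIC end points — boundary points of
`ℚ`-semialgebraic subsets of `ℝ` are algebraic —, `t ↦ p + t/(1−t)` for unbounded pieces; `stub_pushforwardDimOne`).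
[cite: KontsevichZagier2001, §1.2] -/
theorem stub_cells : ∀ c : KZ.FormalRep, c ∈ H₁ →
    ∃ N : KZ.IntegralRep 1 →₀ ℤ,
      (∀ ρ ∈ N.support, ρ.domain = {z | z 0 ∈ Set.Ioo (0 : ℝ) 1} ∧
        ContDiffOn ℝ ((⊤ : ℕ∞) : WithTop ℕ∞) (fun t : ℝ => ρ.integrand (fun _ : Fin 1 => t)) (Set.Ioo (0 : ℝ) 1)) ∧
      c - N.sum (fun ρ m => m • KZ.of ρ) ∈ M₁ := by
  sorry

/-- STUB `stub_arcSymbols` (XL core of `stub_normalisation`; may be split further into `puiseuxFlatten` + `etaleModel`).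
ARCS ARE SYMBOLS: a representation on `(0,1)` with `C^∞` (semialgebraic, integrable) integrand `h` is, modulo `M₁`, a finite
algebraic combination of REAL REALISATIONS of period symbols of curve type along `ℚ`-semialgebraic `C¹` paths, with the same
value. Interior pieces `[p,q] ⊂ (0,1)` away from the finitely many bad points (zeros of `∂_yP(t,h(t))`, `P` a squarefree
polynomial vanishing on the graph) are realisations of `y dt` on the ÉTALE MODEL `{P = 0, w·∂_yP = 1} ⊂ ℂ³` (smooth by
inspection); at a bad end point `p`: Puiseux flattening `t = p + τᵉ` (convergent branches:
`Literature.Analysis.Complex.PuiseuxInfinity.exists_branch_atlas` at `u = 1/(t−p)`), integrability makes the flattened integrand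
`G` analytic at `τ = 0`, and the ÉTALE SHIFT `G = T(τ) + τᴺ u(τ)` (`Literature.FieldTheory.AlgClosed.exists_etaleShift`,
`exists_holomorphic_root`) puts the branch through an étale point, so `[∫ G] = [∫ T] + [∫ τᴺ u]` are realisations on `𝔸¹` and on the
étale model of the shifted polynomial. [cite: HuberWustholz2022, Prop. 12.5 and Cor. 12.7] -/
theorem stub_arcSymbols : ∀ ρ : KZ.IntegralRep 1, ρ.domain = {z | z 0 ∈ Set.Ioo (0 : ℝ) 1} →
    ContDiffOn ℝ ((⊤ : ℕ∞) : WithTop ℕ∞) (fun t : ℝ => ρ.integrand (fun _ : Fin 1 => t)) (Set.Ioo (0 : ℝ) 1) →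
    ∃ (C : PeriodSymbol →₀ ℂ) (R : PeriodSymbol → KZ.IntegralRep 1), (∀ s, IsAlgebraic ℚ (C s)) ∧
      (∀ s ∈ C.support, IsSemialgebraicMapOn ℚ {z : Fin 1 → ℝ | z 0 ∈ Set.Icc (0 : ℝ) 1}
        (fun z => Fin.append (fun i => (s.γ.toFun (z 0) i).re) (fun i => (s.γ.toFun (z 0) i).im))) ∧
      (∀ s ∈ C.support, (R s).domain = {z | z 0 ∈ Set.Ioo (0 : ℝ) 1} ∧ ∀ z ∈ (R s).domain, (R s).integrand z =
        (C s * ∑ i, MvPolynomial.eval (s.γ.toFun (z 0)) (s.ω i) * deriv (fun u => s.γ.toFun u i) (z 0)).re) ∧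
      evalCombination C = ((ρ.value : ℝ) : ℂ) ∧ KZ.of ρ - ∑ s ∈ C.support, KZ.of (R s) ∈ M₁ := by
  sorry

/-- STUB `stub_normalisation` (XL — hardest, the lead's). NORMALISATION `Ψ`: every `c ∈ H₁` is, modulo `M₁`, a sum of
real realisations of period symbols of curve type along `ℚ`-semialgebraic `C¹` paths, with algebraic coefficients and the
same evaluation: cut 1-dimensional representations at the finitely many non-Nash points (1a), compactify unbounded pieces
and rescale to `(0,1)` (rule 2), flatten end points `t = t₀ + sᴺ` (rule 2, Puiseux) and lift each real algebraic arc to a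
smooth affine model over `ℚ̄` on which `h dt` is a polynomial form (integrability of `h` = regularity of `h dt` at the
end-point places). GLUE (lead, to be PROVED from `stub_cells` + `stub_arcSymbols` + `stub_realises` with the additive machinery of
`Theorems/…StubRetractionAlgebra.lean` §3 in `Theorems/…StubNormalisation.lean`). [cite: HuberWustholz2022, Prop. 12.5 and §13.2.1] -/
theorem stub_normalisation : ∀ c : KZ.FormalRep, c ∈ H₁ →
    ∃ (C : PeriodSymbol →₀ ℂ) (R : PeriodSymbol → KZ.IntegralRep 1), (∀ s, IsAlgebraic ℚ (C s)) ∧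
      (∀ s ∈ C.support, IsSemialgebraicMapOn ℚ {z : Fin 1 → ℝ | z 0 ∈ Set.Icc (0 : ℝ) 1}
        (fun z => Fin.append (fun i => (s.γ.toFun (z 0) i).re) (fun i => (s.γ.toFun (z 0) i).im))) ∧
      (∀ s ∈ C.support, (R s).domain = {z | z 0 ∈ Set.Ioo (0 : ℝ) 1} ∧ ∀ z ∈ (R s).domain, (R s).integrand z =
        (C s * ∑ i, MvPolynomial.eval (s.γ.toFun (z 0)) (s.ω i) * deriv (fun u => s.γ.toFun u i) (z 0)).re) ∧
      evalCombination C = ((KZ.eval c : ℝ) : ℂ) ∧ c - ∑ s ∈ C.support, KZ.of (R s) ∈ M₁ := by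
  sorry

/-- STUB `stub_huberWustholz` (the apex — Huber–Wüstholz 2022, Thm 13.3 (2); since route rev 5 it is the ROUTE CRUX
`PeriodConjectureCurveType` (stmt-KontsevichZagierPeriods-14055; `Iff.rfl` with the cite-only tree fact
`HuberWustholzCurvePeriods`), NOT staffed by this line: closing every other stub proves the sibling crux
`CurvePeriodsTransfer` = `this → crux` outright). [cite: HuberWustholz2022, Thm 13.3 (2)] -/
theorem stub_huberWustholz :
    Summit.KontsevichZagierPeriods.KontsevichZagierPeriods.Theses.SymplecticScissors.PeriodConjectureCurveType := by
  sorry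

/-! ## Composition (sorry-free): the stubs imply the crux -/

/-- **The crux `RealOnePeriodRelations` from the stubs of line `nash-retraction-thin-strip` (reshape 2).**
Normalise `c ∈ H₁` to `Σ_s [R s]` with `Ψ(c) = C` (`stub_normalisation`); `eval c = 0` gives
`evalCombination C = 0`, so Huber–Wüstholz writes `C = Σ aₗ ρₗ` with elementary `ρₗ` (`stub_huberWustholz`);
the retraction `Θ` (`stub_retraction`, fed by representatives / coherence / exactness / realisations) kills
`Σ aₗ ρₗ` and agrees with each `[R s]` modulo `M₁`; hence `c ∈ M₁`. [cite: HuberWustholz2022, Thm 13.3 (2)] -/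
theorem RealOnePeriodRelations_of :
    Summit.KontsevichZagierPeriods.KontsevichZagierPeriods.Theses.SymplecticScissors.RealOnePeriodRelations := by
  rw [crux_iff]
  intro c hc heval
  obtain ⟨C, R, hCalg, hSA, hReal, hCeval, hcR⟩ := stub_normalisation c hc
  have hC0 : evalCombination C = 0 := by rw [hCeval, heval]; simp
  obtain ⟨k, ρ, a, hρ, ha, hCsum⟩ := stub_huberWustholz C hCalg hC0
  obtain ⟨Θ, hΘrel, hΘreal⟩ :=
    stub_retraction (stub_saHomotopic stub_saChart (stub_saPathSubset stub_saChart))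
      (stub_homotopyInvariance stub_saChart (stub_saPathSubset stub_saChart) (stub_cellGreen stub_greenOnSquare))
      stub_exactDimOne stub_realises
  -- `Σ_{s ∈ supp C} Θ (C s) s ∈ M₁`
  have h1 : (∑ s ∈ C.support, Θ (C s) s) ∈ M₁ := by
    have h := hΘrel k ρ a hρ ha
    rw [← hCsum] at h
    exact h
  -- each `Θ (C s) s − [R s] ∈ M₁`
  have h2 : (∑ s ∈ C.support, (Θ (C s) s - KZ.of (R s))) ∈ M₁ :=
    sum_mem fun s hs => hΘreal s (C s) (hCalg s) (hSA s hs) (R s) (hReal s hs)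
  have h3 : c = (c - ∑ s ∈ C.support, KZ.of (R s)) - (∑ s ∈ C.support, (Θ (C s) s - KZ.of (R s))) +
      ∑ s ∈ C.support, Θ (C s) s := by
    rw [Finset.sum_sub_distrib]
    abel
  rw [h3]
  exact M₁.add_mem (M₁.sub_mem hcR h2) h1

end Summit.KontsevichZagierPeriods.SymplecticScissors.RealOnePeriodRelations

end
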